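import Literature.AnabelianGeometry.EtaleTheta.FrobenioidThetaToyData

/-!
# [EtTh] §5, Lemma 5.8 / 5.9 (iv): the schemata `ActsByCyclotome`, `ConstantsActByCyclotome`, `IdentifiesPiY`,
# `CyclotomicCharacterCompat` (FACT-LIST F-0534 / F-0535 / F-0533 / F-1307) have REFUTABLE universal closures

Mochizuki, *The étale theta function and its Frobenioid-theoretic manifestations*, Publ. RIMS **45**
(2009), Lemma 5.8 p.331 (PDF p.105), Lemma 5.9 (iv) p.332 (PDF p.106)
[cite: MochizukiEtTh2009, Lem 5.8 p.331 (PDF p.105)].  abc-iut cell, block F (fact-proving wave), seat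
abc-iut-f-120; negative knowledge recorded next to abc-iut-L2-t4's FROZEN `FrobenioidMonoTheta.lean` /
`FrobenioidEnvelopeIso.lean` (nothing landed is edited; no `Prop` fact, no instance, no notation), over the
toy data of `FrobenioidThetaToyData.lean`; companion of the positive file
`Discharge/Sec5Lemma58ActsByCyclotome.lean` (instance forms, p428744).

The four rows are PARAMETRISED predicates over abstract §5 data `𝔉 : ThetaFrobenioid C D` (and, for
F-0533 / F-1307, abstract §2 data `T`, an identification `ι : Π^tp_X̲ ≃ T.PiX`, an identification of
cyclotomes `m`).  Their UNIVERSAL closures are false: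

* `toy₁` (`G = H = 𝔖₃`, `π = id`; units trivial): `(0 1)` does not "act via `μ_N(B_N)`" — its commutator
  with `s^⊓-gp_N(ρ y) = (1 2)` is not a unit ⟹ `not_forall_actsByCyclotome` (**F-0534**); and against the
  toy §2 datum (whose `Π^tp_Y` is the kernel of the OTHER `ℤ`-coordinate) `ι = id` does not carry
  `Π^tp_Y̲` onto `Π^tp_Y` ⟹ `not_forall_identifiesPiY` (**F-0533**);
* `toy₂` (`G = ℤ`, `H = 1`, `O^×(B_N^birat) = ℤ × ℚ^× ⊇ ℚ^×` the constants, `N = 1`): the unit `1 ∈ ℤ`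
  is acted on trivially by `Π^tp_Y` but its first power is not a constant ⟹
  `not_forall_constantsActByCyclotome` (**F-0535**; the `⊆` half of the row holds whenever the birational
  action does, `okxRootN_subset_actsByCyclotome` — only the arithmetic `⊇` half is refutable);
* `toy₃` (`G = ℤ/3 ⋊ ℤ^×`, `H = ℤ^×`, `N = 3`; `μ_3(B_N) = ℤ/3` inverted by `s^⊓-gp_N(−1) = inr(−1)`)
  against the toy §2 datum of level `3` with TRIVIAL character: the compatibility fails for EVERY `ι`, `m`
  (and an `m` exists, `muEquiv₃`) ⟹ `not_forall_cyclotomicCharacterCompat` (**F-1307**).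

So each row is admissible ONLY in its instance form at the genuine data (FACT-LIST class «universal-closure
REFUTED; instance forms open or model-witnessed»): `identifiesPiY_ofThetaEnvData` (F-0533),
`cyclotomicCharacterCompatX_of_galoisDictionary` + `.toY` (F-1307), `actsByCyclotome_of_mem_OKxRootN`
(F-0534), `constantsActByCyclotome_of_conjFixed` / `…_ofModelData` (F-0535).  Elementary group theory;
nothing here bears on the disputed [IUTchIII] Cor. 3.12 or takes a side; refuted-as-a-universal-closure is
a statement about OUR typing of an assumption label, not about [EtTh] (a refereed paper), whose Lemma 5.8
concerns the genuine curve data.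
-/

namespace Literature.AnabelianGeometry.EtaleTheta

open CategoryTheory
open Literature.AlgebraicGeometry.Frobenioids

namespace ThetaFrobenioid

namespace Toy

/-! ### Toy 1: `G = H = 𝔖₃`, `π = id` — trivial units; `Aut_C(B_N)` non-abelian -/

/-- Toy §5 data no. 1: `C = D = B𝔖₃`, base functor the identity, `ρ₀ = s3`, `N = 1`, `K = ℚ`.
[folklore] -/
abbrev toy₁ : ThetaFrobenioid.{0} (SingleObj (Equiv.Perm (Fin 3))) (SingleObj (Equiv.Perm (Fin 3))) :=
  frd (MonoidHom.id _) (fun a b ha hb => by simp only [MonoidHom.id_apply] at ha hb; rw [ha, hb])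
    ℚˣ (unitsHomOf (MonoidHom.id _) ℚˣ 1)
    (unitsHomOf_injective (MonoidHom.id _) ℚˣ 1 (fun a ha b hb _ => by
      simp only [Set.mem_setOf_eq, MonoidHom.id_apply] at ha hb; rw [ha, hb]))
    (MonoidHom.id _) s3 (fun τ => ⟨(1, (1, τ)), rfl⟩) 1 ℚ (MonoidHom.id _) (fun _ _ h => h)

/-- **F-0534, universal closure REFUTED**: in toy no. 1 the automorphism `(0 1)` of `B_N` does NOT act
via multiplication by an element of `μ_N(B_N)` — its commutator with `s^⊓-gp_N(ρ(1,1,(1 2))) = (1 2)` is a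
`3`-cycle, not a unit.  [cite: MochizukiEtTh2009, Lem 5.8 proof p.331 (PDF p.105)] -/
theorem toy₁_not_actsByCyclotome :
    ¬ toy₁.ActsByCyclotome (autEquiv (Equiv.Perm (Fin 3)) (Equiv.swap 0 1)) := by
  intro h
  have hx : ((1, (1, Equiv.swap 1 2)) : Pi) ∈ toy₁.PiY := MonoidHom.mem_ker.mpr rfl
  have hmem := h (toy₁.ρ (1, (1, Equiv.swap 1 2))) ⟨_, hx, rfl⟩
  have hunit := (mem_unitsSubgroup_pre_iff (MonoidHom.id (Equiv.Perm (Fin 3))) _ _).mp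
    (toy₁.muTorsion_le_units _ _ hmem)
  rw [MonoidHom.id_apply] at hunit
  simp only [map_mul, map_inv, homOf_autEquiv] at hunit
  exact absurd hunit (by decide)

/-! ### Toy 2: `G = ℤ`, `H = 1` — every automorphism is a unit, no torsion, trivial `Π`-action -/

/-- Toy §5 data no. 2: `C = Bℤ`, `D = B1`, `O^×(B_N) = Aut_C(B_N) = ℤ ↪ O^×(B_N^birat) := ℤ × ℚ^×`,
constants `ℚ^× ↪ ℤ × ℚ^×` the second factor, `N = 1`, all sections trivial.  [folklore] -/
abbrev toy₂ : ThetaFrobenioid.{0} (SingleObj (Multiplicative ℤ)) (SingleObj Unit) :=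
  frd (1 : Multiplicative ℤ →* Unit) (fun a b _ _ => mul_comm a b)
    (Multiplicative ℤ × ℚˣ)
    (unitsHomOf (1 : Multiplicative ℤ →* Unit) (Multiplicative ℤ × ℚˣ)
      (MonoidHom.inl (Multiplicative ℤ) ℚˣ))
    (unitsHomOf_injective (1 : Multiplicative ℤ →* Unit) (Multiplicative ℤ × ℚˣ)
      (MonoidHom.inl (Multiplicative ℤ) ℚˣ) (fun _ _ _ _ h => (Prod.ext_iff.mp h).1))
    (1 : Unit →* Multiplicative ℤ) (1 : Pi →* Unit) (fun _ => ⟨1, Subsingleton.elim _ _⟩) 1 ℚ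
    (MonoidHom.inr (Multiplicative ℤ) ℚˣ) (fun _ _ h => (Prod.ext_iff.mp h).2)

/-- **F-0535, universal closure REFUTED**: in toy no. 2 the unit `1 ∈ ℤ = O^×(B_N)` is acted on trivially
by `Π^tp_Y` (so "via `μ_N(B_N)`"), but its `N = 1`-st power `(1, 1) ∈ ℤ × ℚ^×` is not a constant: it is NOT
in `(O_K^×)^{1/N}`.  [cite: MochizukiEtTh2009, Lem 5.8 proof p.331 (PDF p.105)] -/
theorem toy₂_not_constantsActByCyclotome : ¬ toy₂.ConstantsActByCyclotome := by
  intro h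
  set u : Aut toy₂.BN := autEquiv (Multiplicative ℤ) (Multiplicative.ofAdd 1) with hu_def
  have hu : u ∈ toy₂.units toy₂.BN :=
    (mem_unitsSubgroup_pre_iff (1 : Multiplicative ℤ →* Unit) _ u).mpr rfl
  have hact : toy₂.ActsByCyclotome u := by
    intro y _
    have hs : toy₂.sgpCap y = 1 := by
      change autEquiv (Multiplicative ℤ)
        ((1 : Unit →* Multiplicative ℤ) ((autEquiv Unit).symm y)) = 1
      rw [MonoidHom.one_apply, map_one]
    rw [hs, one_mul, inv_one, mul_one, mul_inv_cancel]
    exact (toy₂.muTorsion toy₂.BN toy₂.N).one_mem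
  obtain ⟨v, hv, hvu⟩ := (h u).mpr ⟨hu, hact⟩
  have hv' : toy₂.unitsToBirat toy₂.BN v ∈ toy₂.KxRootN := hv
  obtain ⟨k, hk⟩ := toy₂.mem_KxRootN.mp hv'
  have hvu' : (v : Aut toy₂.BN) = u := hvu
  have hfst := congrArg Prod.fst hk
  change (1 : Multiplicative ℤ) =
    (((homOf (Multiplicative ℤ) _ (v : Aut toy₂.BN), (1 : ℚˣ)) : Multiplicative ℤ × ℚˣ) ^
      ((1 : ℕ+) : ℕ)).1 at hfst
  rw [hvu'] at hfst
  exact absurd hfst (by decide)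

/-! ### F-0533 against the toy §2 datum -/

/-- **F-0533, universal closure REFUTED**: for toy no. 1 (whose `Π^tp_Y̲` is the kernel of the FIRST
`ℤ`-coordinate) and the toy §2 datum (whose `Π^tp_Y` is the kernel of the SECOND), the identity
identification does NOT carry `Π^tp_Y̲` onto `Π^tp_Y`: `(0, 1, 1)` lies in the first, not the second.
[cite: MochizukiEtTh2009, Lem 5.9 (iv) p.332 (PDF p.106)] -/
theorem toy₁_not_identifiesPiY :
    ¬ toy₁.IdentifiesPiY (env 1 Unit inferInstance rfl) (MulEquiv.refl _) := by
  intro h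
  have h1 : ((1, (Multiplicative.ofAdd 1, 1)) : Pi) ∈ toy₁.PiY := MonoidHom.mem_ker.mpr rfl
  have h2 := MonoidHom.mem_ker.mp ((h _).mp h1)
  exact absurd h2 (by decide)

/-! ### Toy 3: `G = ℤ/3 ⋊ ℤ^×` over `H = ℤ^×` — units `ℤ/3 = μ_3(B_N)`, inverted by `s^⊓-gp_N(−1)` -/

/-- The inversion action of `ℤ^× = {±1}` on an abelian group: `u ↦ (a ↦ a^u)`. [folklore] -/
def invAction (A : Type) [CommGroup A] : ℤˣ →* MulAut A where
  toFun u :=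
    { toFun := fun a => a ^ (u : ℤ)
      invFun := fun a => a ^ (u : ℤ)
      left_inv := fun a => by
        change (a ^ (u : ℤ)) ^ (u : ℤ) = a
        rw [← zpow_mul, Int.units_coe_mul_self, zpow_one]
      right_inv := fun a => by
        change (a ^ (u : ℤ)) ^ (u : ℤ) = a
        rw [← zpow_mul, Int.units_coe_mul_self, zpow_one]
      map_mul' := fun a b => mul_zpow a b _ }
  map_one' := by
    ext a
    change a ^ ((1 : ℤˣ) : ℤ) = a
    rw [Units.val_one, zpow_one]
  map_mul' u v := by
    ext a
    change a ^ ((u * v : ℤˣ) : ℤ) = (a ^ (v : ℤ)) ^ (u : ℤ)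
    rw [Units.val_mul, zpow_mul']

/-- The toy automorphism group `G₃ := ℤ/3 ⋊ ℤ^×` (dihedral of order `6`). [folklore] -/
abbrev G₃ : Type := Multiplicative (ZMod 3) ⋊[invAction (Multiplicative (ZMod 3))] ℤˣ

/-- The toy base projection `G₃ ↠ ℤ^×`. [folklore] -/
abbrev π₃ : G₃ →* ℤˣ := SemidirectProduct.rightHom

/-- `Ker(G₃ ↠ ℤ^×) = ℤ/3` is abelian. [folklore] -/
private theorem comm_of_π₃ (a b : G₃) (ha : π₃ a = 1) (hb : π₃ b = 1) : a * b = b * a := by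
  change a.right = 1 at ha
  change b.right = 1 at hb
  refine SemidirectProduct.ext ?_ ?_
  · rw [SemidirectProduct.mul_left, SemidirectProduct.mul_left, ha, hb, map_one, MulAut.one_apply,
      MulAut.one_apply, mul_comm]
  · rw [SemidirectProduct.mul_right, SemidirectProduct.mul_right, mul_comm]

/-- `O^×(S) → ℤ/3 × ℚ^×`, `u ↦ (u.left, 1)` — a homomorphism on the `Ker`-automorphisms. [folklore] -/
def leftUnitsHom (S : SingleObj G₃) : (pre π₃).unitsSubgroup S →* Multiplicative (ZMod 3) × ℚˣ where
  toFun u := ((homOf G₃ S u).left, 1)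
  map_one' := rfl
  map_mul' a b := by
    have ha : (homOf G₃ S a).right = 1 := (mem_unitsSubgroup_pre_iff π₃ S _).mp a.2
    refine Prod.ext ?_ (by simp)
    change (homOf G₃ S (a.1 * b.1)).left = (homOf G₃ S a).left * (homOf G₃ S b).left
    rw [map_mul, SemidirectProduct.mul_left]
    change (homOf G₃ S a).left * (invAction _ (homOf G₃ S a).right) (homOf G₃ S b).left = _
    rw [ha, map_one, MulAut.one_apply]

/-- `u ↦ (u.left, 1)` is injective on `O^×(S)`. [folklore] -/
private theorem leftUnitsHom_injective (S : SingleObj G₃) : Function.Injective (leftUnitsHom S) := by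
  intro a b h
  have hl : (homOf G₃ S a).left = (homOf G₃ S b).left := (Prod.ext_iff.mp h).1
  have ha : (homOf G₃ S a).right = 1 := (mem_unitsSubgroup_pre_iff π₃ S _).mp a.2
  have hb : (homOf G₃ S b).right = 1 := (mem_unitsSubgroup_pre_iff π₃ S _).mp b.2
  exact Subtype.ext (homOf_injective G₃ S (SemidirectProduct.ext hl (ha.trans hb.symm)))

/-- `sign ∘ s3 : Π ↠ ℤ^×` is onto. [folklore] -/
private theorem sign_s3_surjective : Function.Surjective ((Equiv.Perm.sign).comp s3) := by
  intro u
  obtain ⟨τ, hτ⟩ := Equiv.Perm.sign_surjective (Fin 3) u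
  exact ⟨(1, (1, τ)), hτ⟩

/-- Toy §5 data no. 3: `C = B(ℤ/3 ⋊ ℤ^×)`, `D = Bℤ^×`, sections `inr`, `ρ₀ = sign ∘ s3`, `N = 3`, `K = ℚ`.
[folklore] -/
abbrev toy₃ : ThetaFrobenioid.{0} (SingleObj G₃) (SingleObj ℤˣ) :=
  frd π₃ comm_of_π₃ (Multiplicative (ZMod 3) × ℚˣ) leftUnitsHom leftUnitsHom_injective
    SemidirectProduct.inr ((Equiv.Perm.sign).comp s3) sign_s3_surjective 3 ℚ
    (MonoidHom.inr (Multiplicative (ZMod 3)) ℚˣ) (fun _ _ h => (Prod.ext_iff.mp h).2)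

/-- The toy §2 datum of level `3` with cyclotome `ℤ/3` and trivial character. [folklore] -/
noncomputable abbrev env₃ : ThetaEnvData.{0} 3 :=
  env 3 (Multiplicative (ZMod 3)) inferInstance (by simp [ZMod.card])

/-- **F-1307, universal closure REFUTED (for EVERY identification `ι` and `m`)**: in toy no. 3 the unit
`1 ∈ ℤ/3 = μ_3(B_N)` is conjugated by `s^⊓-gp_N(ρ(1,1,(0 1))) = inr(−1)` to its inverse, while the character
of the toy §2 datum is trivial.  [cite: MochizukiEtTh2009, Lem 5.8 proof p.331 (PDF p.105)] -/
theorem toy₃_not_cyclotomicCharacterCompat (ι : toy₃.PiX ≃* env₃.PiX)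
    (m : toy₃.muTorsion toy₃.BN toy₃.N ≃* env₃.mu) : ¬ toy₃.CyclotomicCharacterCompat env₃ ι m := by
  intro h
  set g : G₃ := SemidirectProduct.inl (Multiplicative.ofAdd (1 : ZMod 3)) with hg_def
  have hu1 : autEquiv G₃ g ∈ toy₃.units toy₃.BN :=
    (mem_unitsSubgroup_pre_iff π₃ _ _).mpr (by rw [homOf_autEquiv, hg_def, SemidirectProduct.rightHom_inl])
  have hg3 : g ^ (3 : ℕ) = 1 := by
    rw [hg_def, ← map_pow]
    exact congrArg _ (by decide)
  have hu : autEquiv G₃ g ∈ toy₃.muTorsion toy₃.BN toy₃.N := by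
    refine ⟨hu1, ?_⟩
    change autEquiv G₃ g ^ (3 : ℕ) = 1
    rw [← map_pow, hg3, map_one]
  have hy : ((1, (1, Equiv.swap 0 1)) : Pi) ∈ toy₃.PiY := MonoidHom.mem_ker.mpr rfl
  set c : Aut toy₃.BN := toy₃.sgpCap (toy₃.ρ (1, (1, Equiv.swap 0 1))) with hc_def
  have hc0 : homOf G₃ _ c = SemidirectProduct.inr ((Equiv.Perm.sign.comp s3) (1, (1, Equiv.swap 0 1))) :=
    homOf_sgpCap_rho π₃ comm_of_π₃ _ leftUnitsHom leftUnitsHom_injective SemidirectProduct.inr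
      (Equiv.Perm.sign.comp s3) sign_s3_surjective 3 ℚ _ _ (1, (1, Equiv.swap 0 1))
  have hsign : (Equiv.Perm.sign.comp s3) (1, (1, Equiv.swap 0 1)) = -1 :=
    Equiv.Perm.sign_swap (show (0 : Fin 3) ≠ 1 by decide)
  have hc : homOf G₃ _ c = SemidirectProduct.inr (-1) := by rw [hc0, hsign]
  have key := h _ hy ⟨_, hu⟩ ⟨c * autEquiv G₃ g * c⁻¹, (toy₃.muTorsion_normal _ _).conj_mem _ hu c⟩ rfl
  have key' : (⟨c * autEquiv G₃ g * c⁻¹, (toy₃.muTorsion_normal _ _).conj_mem _ hu c⟩ :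
      toy₃.muTorsion toy₃.BN toy₃.N) = ⟨_, hu⟩ := m.injective key
  have key'' := congrArg (fun z : toy₃.muTorsion toy₃.BN toy₃.N => homOf G₃ _ (z : Aut toy₃.BN)) key'
  simp only [map_mul, map_inv, hc, homOf_autEquiv] at key''
  rw [← map_inv, hg_def, ← SemidirectProduct.inl_aut, SemidirectProduct.inl_inj] at key''
  exact absurd key'' (by decide)

/-- `μ_3(B_N) ⥲ ℤ/3` for toy no. 3 (`u ↦ u.left`): an identification of cyclotomes `m` exists, so the
refutation below is not vacuous in `m`.  [folklore] -/
noncomputable def muEquiv₃ : toy₃.muTorsion toy₃.BN toy₃.N ≃* Multiplicative (ZMod 3) :=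
  MulEquiv.ofBijective
    ((MonoidHom.fst _ _).comp ((leftUnitsHom (SingleObj.star G₃)).comp
      (Subgroup.inclusion (toy₃.muTorsion_le_units toy₃.BN toy₃.N))))
    ⟨fun a b h => Subgroup.inclusion_injective _
        (leftUnitsHom_injective (SingleObj.star G₃) (Prod.ext h rfl)),
      fun n => by
        have hn3 : n ^ (3 : ℕ) = 1 := by revert n; decide
        have hu1 : autEquiv G₃ (SemidirectProduct.inl n) ∈ toy₃.units toy₃.BN :=
          (mem_unitsSubgroup_pre_iff π₃ _ _).mpr
            (by rw [homOf_autEquiv, SemidirectProduct.rightHom_inl])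
        refine ⟨⟨autEquiv G₃ (SemidirectProduct.inl n), hu1, ?_⟩, rfl⟩
        change autEquiv G₃ (SemidirectProduct.inl n) ^ (3 : ℕ) = 1
        rw [← map_pow, ← map_pow, hn3, map_one, map_one]⟩

/-! ### The universal closures of the four FACT-LIST schemata are false -/

/-- **F-0534 — universal closure REFUTED.**  "`Π^tp_Y` acts on `u` via multiplication by an element of
`μ_N(B_N)`" is a PREDICATE on `u ∈ Aut_C(B_N)`; over all (universe-`0`) §5 data and all `u` it fails
(toy no. 1).  Admissible only as the hypothesis/instance form it is consumed in (e.g. for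
`u ∈ (O_K^×)^{1/N}`: `actsByCyclotome_of_mem_OKxRootN`).  [cite: MochizukiEtTh2009, Lem 5.8 proof p.331 (PDF p.105)] -/
theorem not_forall_actsByCyclotome :
    ¬ ∀ (C D : Type) [Category.{0} C] [Category.{0} D] (𝔉 : ThetaFrobenioid.{0} C D) (u : Aut 𝔉.BN),
      𝔉.ActsByCyclotome u :=
  fun h => toy₁_not_actsByCyclotome (h _ _ toy₁ _)

/-- **F-0535 — universal closure REFUTED.**  Lemma 5.8's arithmetic step "this last set … coincides with
`(O_K^×)^{1/N}`" is NOT a consequence of the typed §5 interface: toy no. 2 satisfies every structure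
field and violates it (its `⊇` half; the `⊆` half holds whenever the birational action does,
`okxRootN_subset_actsByCyclotome`).  It remains an admissible ASSUMPTION only at the genuine data
(instance/conditional forms `constantsActByCyclotome_of_conjFixed`, `…_ofModelData`).
[cite: MochizukiEtTh2009, Lem 5.8 proof p.331 (PDF p.105)] -/
theorem not_forall_constantsActByCyclotome :
    ¬ ∀ (C D : Type) [Category.{0} C] [Category.{0} D] (𝔉 : ThetaFrobenioid.{0} C D),
      𝔉.ConstantsActByCyclotome :=
  fun h => toy₂_not_constantsActByCyclotome (h _ _ toy₂)

/-- **F-0533 — universal closure REFUTED.**  The dictionary hypothesis "`ι` carries `Π^tp_Y̲` onto `Π^tp_Y`"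
fails for some §5 data, §2 data and identification `ι` (toy no. 1, the toy §2 datum, `ι = id`); it holds
at the named instance `identifiesPiY_ofThetaEnvData`.  [cite: MochizukiEtTh2009, Lem 5.9 (iv) p.332 (PDF p.106)] -/
theorem not_forall_identifiesPiY :
    ¬ ∀ (C D : Type) [Category.{0} C] [Category.{0} D] (𝔉 : ThetaFrobenioid.{0} C D)
      (T : ThetaEnvData.{0} 𝔉.N) (ι : 𝔉.PiX ≃* T.PiX), 𝔉.IdentifiesPiY T ι :=
  fun h => toy₁_not_identifiesPiY (h _ _ toy₁ _ _)

/-- **F-1307 — universal closure REFUTED.**  "`Π^tp_Y` acts on `μ_N(B_N)` via the cyclotomic character"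
fails for toy no. 3 against the toy §2 datum of level `3`, for `ι = id` and the identification of
cyclotomes `muEquiv₃` (indeed for every `ι`, `m`: `toy₃_not_cyclotomicCharacterCompat`); it is an
admissible assumption only at the genuine data (`cyclotomicCharacterCompatX_of_galoisDictionary`).
[cite: MochizukiEtTh2009, Lem 5.8 proof p.331 (PDF p.105)] -/
theorem not_forall_cyclotomicCharacterCompat :
    ¬ ∀ (C D : Type) [Category.{0} C] [Category.{0} D] (𝔉 : ThetaFrobenioid.{0} C D)
      (T : ThetaEnvData.{0} 𝔉.N) (ι : 𝔉.PiX ≃* T.PiX) (m : 𝔉.muTorsion 𝔉.BN 𝔉.N ≃* T.mu),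
      𝔉.CyclotomicCharacterCompat T ι m :=
  fun h => toy₃_not_cyclotomicCharacterCompat (MulEquiv.refl _) muEquiv₃ (h _ _ toy₃ env₃ _ _)

end Toy

end ThetaFrobenioid

end Literature.AnabelianGeometry.EtaleTheta
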